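import Summits.QuantumAdvantage.AdviceFreeQNC0.WalkHardFPairLocal
import Summits.QuantumAdvantage.AdviceFreeQNC0.WalkTubeRank
import HarnessLib

/-!
# Cell qa-qnc0 (odd primes): the JUNTA COROLLARY of rung R7 — polylog GLOBAL juntas with arbitrary tables lose

Planner qa-qnc0-p2 g15, ROUND-15 §3.11 (iv) (the «main term» of rung R11 `WalkHardFLinTests`: after regularisation a
linear-test strategy is an average of junta strategies): a strategy ALL of whose cuts read only a fixed set `J` of
`|J| ≤ (log₂ n)^C` input bits — no degree hypothesis, the tables `y_g : {0,1}^J → {0,1}` are arbitrary and dense —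
wins α's u-walk game on at most `θ·2ⁿ` inputs, `θ = 1 − η₀(p)/4 < 1`, for every prime `p ≠ 3`.

PROOF (`walkHardFJunta`).  A `J`-junta has `𝔽_p`-degree `≤ |J|` (`hasDegF_of_junta`, pattern-degree lemma with the
coordinate bits as features); a junta with `2|J| + 2 ≤ n` misses some adjacent pair `(a, a+1)` (`exists_pair_off_junta`,
each bit kills at most two of the `n − 1` pairs); then NO cut reads the pair, so R7 `walkHardFPairLocal` applies with
`w = 0`.  (For `p = 3` the statement is false: the three-test player is a `3`-junta up to the charge.)

WHAT THIS IS NOT: nothing on strategies reading `ω(polylog)` bits or low-degree non-junta cuts beyond R7; R11 itself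
(twisted transfer operators, regularisation) is NOT here; separation NOT moved.
-/

noncomputable section

namespace Summit.QuantumAdvantage.AdviceFreeQNC0

open Classical
open Finset
open Literature.Computability.MetaComplexity Literature.Computability.MetaComplexity.Smolensky

/-- A `J`-junta Boolean function has `𝔽_p`-degree `≤ |J|`. -/
theorem hasDegF_of_junta {p : ℕ} [Fact p.Prime] {n : ℕ} (J : Finset (Fin n)) (f : (Fin n → Bool) → Bool)
    (hf : ∀ u v : Fin n → Bool, (∀ i ∈ J, u i = v i) → f u = f v) : HasDegF p f J.card := by
  unfold HasDegF
  have h := GapFibre.ind_mem_lowDeg_of_pattern (F := ZMod p) J (fun (i : Fin n) (u : Fin n → Bool) => u i)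
    (fun i _ => bitFn_mem_lowDeg i le_rfl) f hf
  rwa [Nat.mul_one] at h

/-- A junta with `2|J| + 2 ≤ n` misses some adjacent pair `(a, a+1)`. -/
theorem exists_pair_off_junta {n : ℕ} (J : Finset (Fin n)) (hJ : 2 * J.card + 2 ≤ n) :
    ∃ a : ℕ, a + 2 ≤ n ∧ ∀ i ∈ J, i.val ≠ a ∧ i.val ≠ a + 1 := by
  by_contra hcon
  push Not at hcon
  have hsub : Finset.range (n - 1) ⊆ (J.image fun i => i.val) ∪ (J.image fun i => i.val - 1) := by
    intro a ha
    rw [Finset.mem_range] at ha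
    obtain ⟨i, hi, hia⟩ := hcon a (by omega)
    rw [Finset.mem_union, Finset.mem_image, Finset.mem_image]
    by_cases h1 : i.val = a
    · exact Or.inl ⟨i, hi, h1⟩
    · exact Or.inr ⟨i, hi, by have := hia h1; omega⟩
  have hcard := Finset.card_le_card hsub
  rw [Finset.card_range] at hcard
  have h2 := (Finset.card_union_le (J.image fun i => i.val) (J.image fun i => i.val - 1)).trans
    (Nat.add_le_add Finset.card_image_le Finset.card_image_le)
  omega

/-- **Junta corollary of R7**: for every prime `p ≠ 3` there is `θ < 1` such that for every `C` and all large `n`,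
every strategy whose cuts read only a set `J` of `|J| ≤ (log₂ n)^C` input bits (arbitrary tables) wins α's u-walk game
on at most `θ·2ⁿ` inputs. -/
theorem walkHardFJunta (p : ℕ) [Fact p.Prime] (hp3 : p ≠ 3) :
    ∃ θ : ℝ, θ < 1 ∧ ∀ C : ℕ, ∃ n₀ : ℕ, ∀ n ≥ n₀, ∀ c : ℕ, ∀ J : Finset (Fin n),
      J.card ≤ (Nat.log 2 n) ^ C →
      ∀ y : Fin (n + 1) → (Fin n → Bool) → Bool,
        (∀ g, ∀ u v : Fin n → Bool, (∀ i ∈ J, u i = v i) → y g u = y g v) →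
        ((Finset.univ.filter fun u : Fin n → Bool => ringWinU c y u = true).card : ℝ) ≤ θ * (2 : ℝ) ^ n := by
  obtain ⟨θ, hθ, h⟩ := walkHardFPairLocal p hp3
  refine ⟨θ, hθ, fun C => ?_⟩
  obtain ⟨n₁, hn₁⟩ := h C
  obtain ⟨n₂, hn₂⟩ := TubePlanProof.logPow_le_natSqrt C
  refine ⟨max (max n₁ n₂) 16, fun n hn c J hJ y hy => ?_⟩
  have hn1 : n₁ ≤ n := le_trans (le_trans (le_max_left _ _) (le_max_left _ _)) hn
  have hn2 : n₂ ≤ n := le_trans (le_trans (le_max_right _ _) (le_max_left _ _)) hn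
  have hn16 : 16 ≤ n := le_trans (le_max_right _ _) hn
  -- `2|J| + 2 ≤ 4 (log₂ n)^C ≤ 4 √n ≤ n`
  have hsq := hn₂ n hn2
  have h4 : 4 ≤ Nat.sqrt n := by rw [Nat.le_sqrt]; omega
  have hss := Nat.sqrt_le' n
  have hlog1 : 1 ≤ (Nat.log 2 n) ^ C := Nat.one_le_pow _ _ (Nat.log_pos one_lt_two (by omega))
  have hJn : 2 * J.card + 2 ≤ n := by nlinarith
  obtain ⟨a, ha, hJa⟩ := exists_pair_off_junta J hJn
  refine hn₁ n hn1 c 0 a (Nat.zero_le _) ha y (fun g => ?_) (fun g _ u v huv => hy g u v fun i hi =>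
    huv i (hJa i hi).1 (hJa i hi).2)
  have hd := hasDegF_of_junta (p := p) J (y g) (hy g)
  unfold HasDegF at hd ⊢
  exact lowDeg_mono hJ hd

end Summit.QuantumAdvantage.AdviceFreeQNC0

end
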